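import Literature.MathematicalPhysics.QuantumFieldTheory.King1986.TorusAliasDigits
import Literature.MathematicalPhysics.QuantumFieldTheory.King1986.MinimizerAliasRate
import HarnessLib

/-!
# King 1986, PROPOSITION 3.8 (3.71), FIRST LINE, ON THE TORUS FOR THE ACTUAL OPERATORS: the sup-norm two-spacing rate
# `|a_{k+n}G^{η′}_{k+n}Q^*_{k+n}(x′, b) − a_kG^η_kQ^*_k(x, b)| ≤ C·L^{−γk}` of King's block-spin minimiser kernels

**Citation header (reproduction of PUBLISHED and PROVED work; seat `pub-ymgap-dag-n18-b` of the cell `pub-ymgap`,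
Track-A node N18 = NE5 whose PRINTED MODEL of record is this proposition — p. 665: «If we replace such a propagator in
E_φ^{(k+n)}(H̃), the error is the same graph with a difference of propagators on one line. Using the method presented,
this error is bounded, and Proposition 3.8 gives the desired factor L^{−γk}.»; the END of the seat's five-file programme
`MinimizerAliasModes` (p409438: modes, (4.20)–(4.23)) → `MinimizerFourier` (p409751: (4.2) on the torus) →
`MinimizerAliasRate` (p410190: (4.24)–(4.31) assembled, `king_prop38_aliasSums`) → `TorusAliasDigits` (the torus ↔
momentum dictionary, `minimiser_kernel_eq_digitSum`, `sum_digitBox_mul`) → THIS FILE; the template cell's headers list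
«position-space Props 3.8/3.9 of King … not formalised» (`CovarianceRateTorus`, `UniformDecay`) and «the ∫dp′ and the
assembly of Proposition 3.8 (3.71)» (`AveragingWeightRateHolder`) as NOT COVERED — covered here, in sup norm).**
C. King, *The U(1) Higgs model. I. The continuum limit*, Commun. Math. Phys. **102** (1986) 649–677 [King1986], §3.4
Proposition 3.8 (3.71) p. 664; §4 pp. 670–674.  Page images READ AS IMAGES by this seat: `b2b-balaban-template/king-
renders/1986-cmp102-king-u1-higgs-I-p016-x2.png` (p. 664), `…-p022-x2.png` (p. 670), `…-p024-x2.png` (p. 672),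
`…-p025-x2.png` (p. 673), `…-p026-x2.png` (p. 674).  King's paper is TEMPLATE LITERATURE (a printed and proved `A = 0`
mechanism); nothing in this file is about Bałaban's covariant objects.

**What King prints (verbatim, p. 664).**  «First, we replace the propagators on the external lines, using the following
proposition proved in Sect. 4. When x′ ∈ T_{η′}, we denote by x that point in T_η for which x′ ∈ B^n(x).
**Proposition 3.8.** For x′, y′ ∈ T_{η′}, 0 < α < 1, and γ sufficiently small,
|a_{k+n}G^{η′}_{k+n}Q^*_{k+n}(x′, z) − a_kG^η_kQ^*_k(x, z)|, |a_{k+n}∂^{η′}_μG^{η′}_{k+n}Q^*_{k+n}(x′, z) − a_k∂^η_μG^η_kQ^*_k(x, z)|,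
|(∂_α(x′, y′)a_{k+n}G^{η′}_{k+n}Q^*_{k+n})(z) − (∂_α(x, y)a_kG^η_kQ^*_k)(z)|, |(∂_α(x′, y′)a_{k+n}∂^{η′}_μG^{η′}_{k+n}Q^*_{k+n})(z)
− (∂_α(x, y)a_k∂^η_μG^η_kQ^*_k)(z)| ≦ CL^{−γk} exp[−δ₀{|x − z|, dist({x, y}, z)}]. (3.71)»; p. 674: «Therefore every term
in (4.19) for m = 0 can be replaced, and so combining our bounds with Theorem 3.3 we deduce (3.71).»

**What this file PROVES (kernel; NO `def`, no named fact).**  On every unit torus `Ω = Π_μ ℤ/M_μ` with the two fine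
tori `T_η = Π_μ ℤ/(L^kM_μ)`, `T_{η′} = Π_μ ℤ/(L^nL^kM_μ)` (`L` ODD, `L ≥ 2`, `k, n ≥ 1`), for King's ACTUAL `A = 0` minimiser
kernels `ℋ_k(x, b) = (a_kG^η_kQ^*_kδ_b)(x) = minimiser (L^k) M a_k (L^{2k}) m² δ_b x` of `EffectiveLaplacianSymbol` (with
`A₀ = L^{2k}(−Δ) + m² + a_kQ*Q` = King's `Δ^η + m²` in `η`-units and King's constants `a_k = aK a L k` of (2.13),
`m² > 0`, `a > 0`) and `ℋ_{k+n}` likewise at `L^nL^k`: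
* §1 `abs_pos_sub_le`: «x′ ∈ B^n(x)» typed as `x_μ = ⌊x′_μ/L^n⌋` gives positions `ξ = x/L^k`, `ξ′ = x′/(L^nL^k)` in
  unit-lattice coordinates with `|ξ′_μ − ξ_μ| ≤ L^{−k}` (King's `|x − x′| ≦ L^{−k}` of (4.24)).
* §2 `norm_digitSum_sub_le` (King's split of (4.19) into `m ≠ 0` and `m = 0` terms, in norm) and the END
  **`king_prop38_torus`**: for `0 ≤ γ ≤ 1` and every `b ∈ Ω`, `x′` over `x`,
  `|ℋ_{k+n}(x′, b) − ℋ_k(x, b)| ≤ (C₁ + C₂)·L^{−γk}`, `C₁ = prop38RateConst a a θ (π²/4)^d d γ`,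
  `C₂ = prop38PosConst a (π²/4)^d d γ`, `θ = lemma43Const a L k n` (closed expressions of `MinimizerAliasModes`; their
  only `k, n`-dependence is through `a_k, a_n ∈ [a(1 − L⁻²), a]`) — UNIFORM in `x′`, `b`, the volume `M`, the mass and `n`.
  Proof = King's pp. 670–674 verbatim: both kernels are the digit sums (4.2)/(4.19) (`minimiser_kernel_eq_digitSum`),
  the fine digits re-index as `l + m` (`sum_digitBox_mul`), and for each reduced momentum `p′ = sOf q` the alias sums of
  the difference are `≤ C₁L^{−γk} + C₂|ξ′ − ξ|^γ` (`king_prop38_aliasSums`: (4.23) for `m ≠ 0`; (4.24), (4.29), (4.18),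
  (4.31) for `m = 0`); averaging over the `|Ω|` reduced momenta (King's `(2π)^{−d}∫dp′`) costs nothing.
* §3 **`abs_minimiser_kernel_le_unif`**: the UNIFORM BOUND `|ℋ_k(x, b)| ≤ (π/2)^d[(π²/4)^{d+1} + a(π²/4)C(d,−1)]` (odd
  `N`, any volume and mass; the size half of King's Prop. 3.7 / Theorem 3.3 for `a_kG_kQ^*_k`, from (4.2) and the alias
  sum (4.22) at `α = −1`; the decay half is NOT here).
* §4 **`king_prop38_torus_of_decay`** — «combining our bounds with Theorem 3.3»: IF both kernels obey
  `|ℋ(·, b)| ≤ c₀e^{−δ₀t}` at the point pair (Theorem 3.3's decay, an INPUT), then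
  `|ℋ_{k+n}(x′,b) − ℋ_k(x,b)| ≤ √(2c₀(C₁+C₂)L^{−γk})·e^{−δ₀t/2}` (`abs_le_sqrt_mul_exp_half` of `CovarianceRate`) — the
  printed shape `CL^{−γ′k}exp[−δ₀′|x − z|]` of (3.71) with `γ′ = γ/2`, `δ₀′ = δ₀/2`.

**NOT COVERED.**  Theorem 3.3 itself (the uniform decay of `ℋ_k`, [Ba 4] = Bałaban 1983; the lit-balaban cell's
`B4Thm110ZeroTorus` is the tree's zero-field torus instance, in the `B1RG242Torus` currency — a currency bridge to
`EffectiveLaplacianSymbol.minimiser` is the remaining input for (3.71) as printed); the Hölder and derivative lines of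
(3.71); even `L`; free boundary conditions / multiple reflections; `A ≠ 0`; Proposition 3.9.  HONEST FRAMING: King's `A = 0` scalar MODEL of the
two-spacing («η-rate») mechanism which the T⁴ programme's node NE5 postulates for Bałaban's one-step outputs — template
literature on a finite torus; nothing about Bałaban's covariant block averaging; nothing continuum / mass-gap / Clay;
count-neutral for the cell's 27 nodes.
-/

noncomputable section

open Finset Real Matrix
open scoped BigOperators ComplexConjugate

namespace Literature.MathematicalPhysics.QuantumFieldTheory.King1986

open Literature.MathematicalPhysics.QuantumFieldTheory.Balaban1983to89
open Literature.MathematicalPhysics.QuantumFieldTheory.Balaban1983to89.B5Prop11Plancherel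

namespace Torus

variable {d : ℕ}

/-! ## §1 «When x′ ∈ T_{η′}, we denote by x that point in T_η for which x′ ∈ B^n(x)» — the positions are `L^{−k}`-close -/

/-- If `x` is the coarse point under `x′` (`x_μ = ⌊x′_μ/R⌋`), the unit-lattice coordinates `ξ = x/N`, `ξ′ = x′/(RN)` satisfy
`|ξ′_μ − ξ_μ| ≤ N⁻¹` (indeed `0 ≤ ξ′_μ − ξ_μ < N⁻¹`). [cite: King1986, p.664 (before Prop. 3.8), (4.24) p.673] -/
theorem abs_pos_sub_le {N R : ℕ} (hN : 1 ≤ N) (hR : 1 ≤ R) {v v' : ℕ} (hv : v = v' / R) :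
    |(v' : ℝ) / ((R * N : ℕ) : ℝ) - (v : ℝ) / N| ≤ (N : ℝ)⁻¹ := by
  have hRr : (0 : ℝ) < R := by exact_mod_cast (show 0 < R by omega)
  have hNr : (0 : ℝ) < N := by exact_mod_cast (show 0 < N by omega)
  have hdm := Nat.div_add_mod v' R
  have hlt : v' % R < R := Nat.mod_lt _ (by omega)
  have hv' : (v' : ℝ) = (R : ℝ) * v + (v' % R : ℕ) := by
    rw [hv]; exact_mod_cast hdm.symm
  have hr0 : (0 : ℝ) ≤ ((v' % R : ℕ) : ℝ) := Nat.cast_nonneg _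
  have hrR : ((v' % R : ℕ) : ℝ) ≤ R - 1 := by
    have h' : (((v' % R) + 1 : ℕ) : ℝ) ≤ R := by exact_mod_cast hlt
    push_cast at h'; linarith
  rw [Nat.cast_mul, hv']
  have hid : ((R : ℝ) * v + ((v' % R : ℕ) : ℝ)) / ((R : ℝ) * N) - (v : ℝ) / N
      = ((v' % R : ℕ) : ℝ) / ((R : ℝ) * N) := by
    field_simp; ring
  rw [hid, abs_of_nonneg (by positivity)]
  calc ((v' % R : ℕ) : ℝ) / ((R : ℝ) * N) ≤ (R : ℝ) / ((R : ℝ) * N) := by gcongr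
    _ = (N : ℝ)⁻¹ := by field_simp

/-! ## §2 Proposition 3.8 (3.71), first line, on the torus: the sup-norm two-spacing rate of the minimiser kernel -/

/-- `0` is a digit. [cite: King1986, (4.2) p.670] -/
theorem zero_mem_digitBox (dd N : ℕ) : (0 : Fin dd → ℤ) ∈ digitBox dd N :=
  (mem_digitBox N).mpr fun μ => by rw [Pi.zero_apply, abs_zero]; exact Nat.cast_nonneg _

/-- The alias sums of one reduced momentum, split as King splits (4.19): `Σ_{l+m} T_B − Σ_l T_A = Σ_l Σ_{m≠0} T_B(l+m) +
Σ_l (T_B(l) − T_A(l))`, in norm. [cite: King1986, (4.19)–(4.23) p.672] -/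
theorem norm_digitSum_sub_le {N R : ℕ} (TB TA : (Fin d → ℤ) → ℂ) :
    ‖(∑ j ∈ digitBox d N, ∑ c ∈ digitBox d R, TB (j + (N : ℤ) • c)) - ∑ j ∈ digitBox d N, TA j‖
      ≤ (∑ j ∈ digitBox d N, ∑ c ∈ (digitBox d R).erase 0, ‖TB (j + (N : ℤ) • c)‖)
        + ∑ j ∈ digitBox d N, ‖TB j - TA j‖ := by
  rw [← Finset.sum_sub_distrib, ← Finset.sum_add_distrib]
  refine (norm_sum_le _ _).trans (Finset.sum_le_sum fun j _ => ?_)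
  have hsplit : ∑ c ∈ digitBox d R, TB (j + (N : ℤ) • c)
      = TB j + ∑ c ∈ (digitBox d R).erase 0, TB (j + (N : ℤ) • c) := by
    rw [← Finset.add_sum_erase (digitBox d R) (fun c => TB (j + (N : ℤ) • c)) (zero_mem_digitBox d R)]
    simp only [smul_zero, add_zero]
  rw [hsplit, show TB j + ∑ c ∈ (digitBox d R).erase 0, TB (j + (N : ℤ) • c) - TA j
      = (∑ c ∈ (digitBox d R).erase 0, TB (j + (N : ℤ) • c)) + (TB j - TA j) by ring]
  exact (norm_add_le _ _).trans (add_le_add (norm_sum_le _ _) le_rfl)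

/-- **KING'S PROPOSITION 3.8, FIRST LINE OF (3.71), ON THE TORUS, SUP-NORM FORM, FOR THE ACTUAL OPERATORS.**  Let `L` be
odd, `L ≥ 2` (so `L ≥ 3`), `k, n ≥ 1`, `a > 0`, `m² > 0`, `Ω = Π_μ ℤ/M_μ` any unit torus, and let
`ℋ_k = minimiser (L^k) M a_k (L^{2k}) m²` and `ℋ_{k+n} = minimiser (L^nL^k) M a_{k+n} ((L^nL^k)²) m²` be King's block-spin
minimiser kernels `a_kG^η_kQ^*_k` (`η = L^{−k}`), `a_{k+n}G^{η′}_{k+n}Q^*_{k+n}` (`η′ = L^{−k−n}`) with King's constants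
`a_k, a_{k+n}` ((2.13)) — the ACTUAL operators of `EffectiveLaplacianSymbol` on the two fine tori over the SAME unit torus.
If `x′ ∈ T_{η′}` lies in the `L^n`-block over `x ∈ T_η` (`x_μ = ⌊x′_μ/L^n⌋`), then for every unit site `b` and every
`0 ≤ γ ≤ 1`:  `|ℋ_{k+n}(x′, b) − ℋ_k(x, b)| ≤ (C₁ + C₂)·L^{−γk}`, `C₁ = prop38RateConst a a θ (π²/4)^d d γ`,
`C₂ = prop38PosConst a (π²/4)^d d γ`, `θ = lemma43Const a L k n` — uniformly in `x′`, `b`, the volume `M`, the mass and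
`n`.  Proof = King's: the kernels are the digit sums (4.2)/(4.19) (`minimiser_kernel_eq_digitSum`, `sum_digitBox_mul`), and
for every reduced momentum the alias sums of the difference obey `king_prop38_aliasSums` with `|x − x′| ≤ L^{−k}`.  The
exponential factor `exp[−δ₀|x − z|]` of (3.71) is King's «combining our bounds with Theorem 3.3» and is NOT asserted
here. [cite: King1986, Prop. 3.8 (3.71) p.664; (4.19)–(4.31) pp.672–674] -/
theorem king_prop38_torus (hd : 0 < d) {L : ℕ} [NeZero L] (hLodd : Odd L) (hL : 2 ≤ L) {k n : ℕ} (hk : 1 ≤ k)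
    (hn : 1 ≤ n) (M : Fin d → ℕ) [hM : ∀ μ, NeZero (M μ)] {a m2 : ℝ} (ha : 0 < a) (hm : 0 < m2)
    {γ : ℝ} (hγ0 : 0 ≤ γ) (hγ1 : γ ≤ 1) (b : Tor M) (x : Tor (fine (L ^ k) M))
    (x' : Tor (fine (L ^ n * L ^ k) M)) (hx : ∀ μ, (x μ).val = (x' μ).val / L ^ n) :
    |minimiser (L ^ n * L ^ k) M (aK a L (k + n)) (((L ^ n * L ^ k : ℕ) : ℝ) ^ 2) m2 (Pi.single b 1) x'
        - minimiser (L ^ k) M (aK a L k) (((L ^ k : ℕ) : ℝ) ^ 2) m2 (Pi.single b 1) x|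
      ≤ (prop38RateConst a a (lemma43Const a L k n) ((π ^ 2 / 4) ^ d) d γ + prop38PosConst a ((π ^ 2 / 4) ^ d) d γ)
        * ((L ^ k : ℕ) : ℝ) ^ (-γ) := by
  -- elementary facts
  have hLr : (1 : ℝ) < L := by exact_mod_cast (lt_of_lt_of_le one_lt_two hL)
  have hNodd : Odd (L ^ k) := hLodd.pow
  have hRodd : Odd (L ^ n) := hLodd.pow
  have hN'odd : Odd (L ^ n * L ^ k) := hRodd.mul hNodd
  have hN1 : 1 ≤ L ^ k := Nat.one_le_pow _ _ (by omega)
  have hR1 : 1 ≤ L ^ n := Nat.one_le_pow _ _ (by omega)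
  have hN'1 : 1 ≤ L ^ n * L ^ k := Nat.one_le_iff_ne_zero.mpr (mul_ne_zero (by omega) (by omega))
  have haA : 0 < aK a L k := aK_pos ha hLr hk
  have haB : 0 < aK a L (k + n) := aK_pos ha hLr (by omega)
  have hNr : (0 : ℝ) < ((L ^ k : ℕ) : ℝ) := by exact_mod_cast (show 0 < L ^ k by omega)
  have hcard : (Fintype.card (Tor M) : ℝ) ≠ 0 := by exact_mod_cast Fintype.card_ne_zero
  -- the positions in unit-lattice coordinates are `L^{-k}`-close
  have hξξ : ∀ μ, |((x' μ).val : ℝ) / ((L ^ n * L ^ k : ℕ) : ℝ) - ((x μ).val : ℝ) / ((L ^ k : ℕ) : ℝ)|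
      ≤ (((L ^ k : ℕ) : ℝ))⁻¹ := fun μ => abs_pos_sub_le hN1 hR1 (hx μ)
  -- the two kernels as digit sums
  have hA := minimiser_kernel_eq_digitSum (L ^ k) M hNodd hN1 haA hm b x
  have hB := minimiser_kernel_eq_digitSum (L ^ n * L ^ k) M hN'odd hN'1 haB hm b x'
  -- the difference of the alias sums at one reduced momentum, bounded by King's momentum-space estimate
  have hq : ∀ q : Tor M,
      ‖(∑ w ∈ digitBox d (L ^ n * L ^ k),
          modeTerm (DeltaEff (aK a L (k + n)) (L ^ n * L ^ k) m2 (sOf M q)) (((L ^ n * L ^ k : ℕ) : ℝ))⁻¹ m2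
            (aliasPt (sOf M q) w) (fun μ => ((x' μ).val : ℝ) / ((L ^ n * L ^ k : ℕ) : ℝ)))
        - ∑ j ∈ digitBox d (L ^ k),
          modeTerm (DeltaEff (aK a L k) (L ^ k) m2 (sOf M q)) (((L ^ k : ℕ) : ℝ))⁻¹ m2 (aliasPt (sOf M q) j)
            (fun μ => ((x μ).val : ℝ) / ((L ^ k : ℕ) : ℝ))‖
      ≤ (prop38RateConst a a (lemma43Const a L k n) ((π ^ 2 / 4) ^ d) d γ
          + prop38PosConst a ((π ^ 2 / 4) ^ d) d γ) * ((L ^ k : ℕ) : ℝ) ^ (-γ) := by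
    intro q
    rw [show digitBox d (L ^ n * L ^ k) = digitBox d (L ^ k * L ^ n) by rw [Nat.mul_comm],
      sum_digitBox_mul hNodd hRodd]
    refine (norm_digitSum_sub_le (N := L ^ k) (R := L ^ n)
      (fun w => modeTerm (DeltaEff (aK a L (k + n)) (L ^ n * L ^ k) m2 (sOf M q)) (((L ^ n * L ^ k : ℕ) : ℝ))⁻¹ m2
        (aliasPt (sOf M q) w) (fun μ => ((x' μ).val : ℝ) / ((L ^ n * L ^ k : ℕ) : ℝ)))
      (fun j => modeTerm (DeltaEff (aK a L k) (L ^ k) m2 (sOf M q)) (((L ^ k : ℕ) : ℝ))⁻¹ m2 (aliasPt (sOf M q) j)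
        (fun μ => ((x μ).val : ℝ) / ((L ^ k : ℕ) : ℝ)))).trans ?_
    have hK := king_prop38_aliasSums hd ha hL hk hn hm hγ0 hγ1 (abs_sOf_le M q)
      (J := digitBox d (L ^ k)) (B := digitBox d (L ^ n))
      (fun j hj μ => two_abs_lt_of_mem_digitBox (L ^ k) hNodd hj μ)
      (fun c hc μ => two_abs_lt_of_mem_digitBox (L ^ n) hRodd hc μ)
      (ξ := fun μ => ((x μ).val : ℝ) / ((L ^ k : ℕ) : ℝ))
      (ξ' := fun μ => ((x' μ).val : ℝ) / ((L ^ n * L ^ k : ℕ) : ℝ))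
      (inv_nonneg.mpr hNr.le) hξξ
    rw [← Nat.cast_mul] at hK
    refine hK.trans (le_of_eq ?_)
    rw [Real.inv_rpow hNr.le, ← Real.rpow_neg hNr.le]
    ring
  -- the difference of the kernels as `|Ω|⁻¹ Σ_q e^{−iq·b}(S_B(q) − S_A(q))`
  have hdiff : (((minimiser (L ^ n * L ^ k) M (aK a L (k + n)) (((L ^ n * L ^ k : ℕ) : ℝ) ^ 2) m2 (Pi.single b 1) x'
      - minimiser (L ^ k) M (aK a L k) (((L ^ k : ℕ) : ℝ) ^ 2) m2 (Pi.single b 1) x : ℝ)) : ℂ)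
      = (Fintype.card (Tor M) : ℂ)⁻¹ * ∑ q : Tor M, conj (chi M q b)
          * ((∑ w ∈ digitBox d (L ^ n * L ^ k),
              modeTerm (DeltaEff (aK a L (k + n)) (L ^ n * L ^ k) m2 (sOf M q)) (((L ^ n * L ^ k : ℕ) : ℝ))⁻¹ m2
                (aliasPt (sOf M q) w) (fun μ => ((x' μ).val : ℝ) / ((L ^ n * L ^ k : ℕ) : ℝ)))
            - ∑ j ∈ digitBox d (L ^ k),
              modeTerm (DeltaEff (aK a L k) (L ^ k) m2 (sOf M q)) (((L ^ k : ℕ) : ℝ))⁻¹ m2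
                (aliasPt (sOf M q) j) (fun μ => ((x μ).val : ℝ) / ((L ^ k : ℕ) : ℝ))) := by
    rw [Complex.ofReal_sub, hB, hA, ← mul_sub, ← Finset.sum_sub_distrib]
    congr 1
    refine Finset.sum_congr rfl fun q _ => ?_
    ring
  have hnorm : ∀ r : ℝ, |r| = ‖((r : ℝ) : ℂ)‖ := fun r => by rw [Complex.norm_real, Real.norm_eq_abs]
  have hchi : ∀ q : Tor M, ‖conj (chi M q b)‖ = 1 := fun q => by
    rw [conj_chi]; unfold chi; rw [norm_prod]
    exact Finset.prod_eq_one fun μ _ => by rw [ZMod.stdAddChar_apply, Circle.norm_coe]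
  rw [hnorm, hdiff, norm_mul, norm_inv, Complex.norm_natCast]
  set Bd : ℝ := (prop38RateConst a a (lemma43Const a L k n) ((π ^ 2 / 4) ^ d) d γ
      + prop38PosConst a ((π ^ 2 / 4) ^ d) d γ) * ((L ^ k : ℕ) : ℝ) ^ (-γ) with hBd
  have hsum : ‖∑ q : Tor M, conj (chi M q b)
        * ((∑ w ∈ digitBox d (L ^ n * L ^ k),
            modeTerm (DeltaEff (aK a L (k + n)) (L ^ n * L ^ k) m2 (sOf M q)) (((L ^ n * L ^ k : ℕ) : ℝ))⁻¹ m2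
              (aliasPt (sOf M q) w) (fun μ => ((x' μ).val : ℝ) / ((L ^ n * L ^ k : ℕ) : ℝ)))
          - ∑ j ∈ digitBox d (L ^ k),
            modeTerm (DeltaEff (aK a L k) (L ^ k) m2 (sOf M q)) (((L ^ k : ℕ) : ℝ))⁻¹ m2
              (aliasPt (sOf M q) j) (fun μ => ((x μ).val : ℝ) / ((L ^ k : ℕ) : ℝ)))‖
      ≤ ∑ _q : Tor M, Bd := by
    refine (norm_sum_le _ _).trans (Finset.sum_le_sum fun q _ => ?_)
    rw [norm_mul, hchi q, one_mul]
    exact hq q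
  calc (Fintype.card (Tor M) : ℝ)⁻¹ * _ ≤ (Fintype.card (Tor M) : ℝ)⁻¹ * ∑ _q : Tor M, Bd :=
        mul_le_mul_of_nonneg_left hsum (by positivity)
    _ = Bd := by
        rw [Finset.sum_const, Finset.card_univ, nsmul_eq_mul, ← mul_assoc, inv_mul_cancel₀ hcard, one_mul]

/-! ## §3 The uniform bound of the minimiser kernel (King's Prop. 3.7 / Thm 3.3 size, without the decay) -/

/-- **UNIFORM BOUND OF THE MINIMISER KERNEL** (the size half of King's Prop. 3.7 / Theorem 3.3 for `a_kG_kQ_k^*`, via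
(4.2) and the alias sums — NOT the decay): for odd `N`, `a > 0`, `m² > 0`, every torus, every `x`, `b`:
`|ℋ_k(x, b)| ≤ (π/2)^d·[(π²/4)^{d+1} + a_k(π²/4)·C(d,−1)]` with `C(d,−1) = aliasConst d (−1)` of (4.22) — uniformly in
`N = L^k`, the volume and the mass. [cite: King1986, Prop. 3.7 p.663, (4.2) p.670, (4.20)–(4.22) p.672] -/
theorem abs_minimiser_kernel_le_unif (hd : 0 < d) {N : ℕ} [NeZero N] (hN : Odd N) (hN1 : 1 ≤ N)
    (M : Fin d → ℕ) [hM : ∀ μ, NeZero (M μ)] {a m2 : ℝ} (ha : 0 < a) (hm : 0 < m2) (b : Tor M)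
    (x : Tor (fine N M)) :
    |minimiser N M a ((N : ℝ) ^ 2) m2 (Pi.single b 1) x|
      ≤ (π / 2) ^ d * ((π ^ 2 / 4) ^ d * (π ^ 2 / 4) + a * (π ^ 2 / 4) * aliasConst d (-1)) := by
  have hNr : (0 : ℝ) < N := by exact_mod_cast (show 0 < N by omega)
  have hη : (0 : ℝ) < (N : ℝ)⁻¹ := inv_pos.mpr hNr
  have hcard : (Fintype.card (Tor M) : ℝ) ≠ 0 := by exact_mod_cast Fintype.card_ne_zero
  have hA := minimiser_kernel_eq_digitSum N M hN hN1 ha hm b x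
  set Bd : ℝ := (π / 2) ^ d * ((π ^ 2 / 4) ^ d * (π ^ 2 / 4) + a * (π ^ 2 / 4) * aliasConst d (-1)) with hBd
  -- per reduced momentum: the alias sum of the mode amplitudes
  have hq : ∀ q : Tor M,
      ‖∑ w ∈ digitBox d N, modeTerm (DeltaEff a N m2 (sOf M q)) (N : ℝ)⁻¹ m2 (aliasPt (sOf M q) w)
          (fun μ => ((x μ).val : ℝ) / N)‖ ≤ Bd := by
    intro q
    have hp : ∀ μ, |sOf M q μ| ≤ π := abs_sOf_le M q
    have hΔ0 : 0 ≤ DeltaEff a N m2 (sOf M q) := DeltaEff_nonneg ha.le N hm.le _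
    have hΔa : DeltaEff a N m2 (sOf M q) ≤ a := DeltaEff_le ha N hm.le _
    have hzone : ∀ j ∈ digitBox d N, ∀ μ, |(N : ℝ)⁻¹ * aliasPt (sOf M q) j μ| ≤ π := by
      intro j hj μ
      rw [abs_mul, abs_of_pos hη, inv_mul_le_iff₀ hNr, mul_comm]
      exact zoneA_of_digit hp (two_abs_lt_of_mem_digitBox N hN hj) μ
    -- split off the central digit
    rw [← Finset.add_sum_erase _ _ (zero_mem_digitBox d N)]
    refine (norm_add_le _ _).trans ?_
    have hcentral : ‖modeTerm (DeltaEff a N m2 (sOf M q)) (N : ℝ)⁻¹ m2 (aliasPt (sOf M q) 0)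
        (fun μ => ((x μ).val : ℝ) / N)‖ ≤ (π / 2) ^ d * ((π ^ 2 / 4) ^ d * (π ^ 2 / 4)) := by
      rw [norm_modeTerm hΔ0 hm.le, modeAmp]
      have h0 : aliasPt (sOf M q) 0 = sOf M q := by funext μ; simp [aliasPt]
      rw [h0]
      have hz : ∀ μ, |(N : ℝ)⁻¹ * sOf M q μ| ≤ π := fun μ => by
        have := hzone 0 (zero_mem_digitBox d N) μ; rwa [h0] at this
      have hcen := DeltaEff_le_mul_latticeSymbol_of_mass ha hN1 hm hp
      have hr := central_ratio_le (ne_of_gt hη) (ne_of_gt hη) hm.le (by positivity) hz hcen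
      calc DeltaEff a N m2 (sOf M q) * (latticeSymbol (N : ℝ)⁻¹ m2 (sOf M q))⁻¹ * ‖uWeight (N : ℝ)⁻¹ (sOf M q)‖
          ≤ ((π ^ 2 / 4) ^ d * (π ^ 2 / 4)) * (π / 2) ^ d :=
            mul_le_mul hr (norm_uWeight_le hη hz) (norm_nonneg _) (by positivity)
        _ = (π / 2) ^ d * ((π ^ 2 / 4) ^ d * (π ^ 2 / 4)) := by ring
    have hfar : ‖∑ w ∈ (digitBox d N).erase 0, modeTerm (DeltaEff a N m2 (sOf M q)) (N : ℝ)⁻¹ m2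
        (aliasPt (sOf M q) w) (fun μ => ((x μ).val : ℝ) / N)‖ ≤ (π / 2) ^ d * (a * (π ^ 2 / 4) * aliasConst d (-1)) := by
      refine (norm_sum_le _ _).trans ?_
      calc ∑ w ∈ (digitBox d N).erase 0, ‖modeTerm (DeltaEff a N m2 (sOf M q)) (N : ℝ)⁻¹ m2
              (aliasPt (sOf M q) w) (fun μ => ((x μ).val : ℝ) / N)‖
          ≤ ∑ w ∈ (digitBox d N).erase 0, a * (π ^ 2 / 4) * (π / 2) ^ d * aliasTerm (-1) (sOf M q) w := by
            refine Finset.sum_le_sum fun w hw => ?_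
            have hw0 : w ≠ 0 := (Finset.mem_erase.mp hw).1
            have hwB : w ∈ digitBox d N := (Finset.mem_erase.mp hw).2
            rw [norm_modeTerm hΔ0 hm.le]
            refine (modeAmp_alias_le hη hm.le hΔ0 hp hw0 (hzone w hwB)).trans ?_
            have hq1 := one_le_norm_aliasPt hp hw0
            unfold aliasTerm
            rw [show ((-1 : ℝ) - 1) = -2 by norm_num]
            have hW := aliasWeight_nonneg (sOf M q) w
            have hpow : 0 ≤ ‖aliasPt (sOf M q) w‖ ^ (-2 : ℝ) := Real.rpow_nonneg (norm_nonneg _) _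
            calc DeltaEff a N m2 (sOf M q) * (π ^ 2 / 4 * ‖aliasPt (sOf M q) w‖ ^ (-2 : ℝ))
                  * ((π / 2) ^ d * aliasWeight (sOf M q) w)
                ≤ a * (π ^ 2 / 4 * ‖aliasPt (sOf M q) w‖ ^ (-2 : ℝ)) * ((π / 2) ^ d * aliasWeight (sOf M q) w) := by
                  gcongr
              _ = a * (π ^ 2 / 4) * (π / 2) ^ d * (‖aliasPt (sOf M q) w‖ ^ (-2 : ℝ) * aliasWeight (sOf M q) w) := by
                  ring
        _ = a * (π ^ 2 / 4) * (π / 2) ^ d * ∑ w ∈ (digitBox d N).erase 0, aliasTerm (-1) (sOf M q) w := by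
            rw [Finset.mul_sum]
        _ ≤ a * (π ^ 2 / 4) * (π / 2) ^ d * aliasConst d (-1) :=
            mul_le_mul_of_nonneg_left (alias_sum_le_of_subset hd (by norm_num) hp (Finset.notMem_erase 0 _))
              (by positivity)
        _ = (π / 2) ^ d * (a * (π ^ 2 / 4) * aliasConst d (-1)) := by ring
    rw [hBd]
    nlinarith [hcentral, hfar]
  -- average over the reduced momenta
  have hnorm : ∀ r : ℝ, |r| = ‖((r : ℝ) : ℂ)‖ := fun r => by rw [Complex.norm_real, Real.norm_eq_abs]
  have hchi : ∀ q : Tor M, ‖conj (chi M q b)‖ = 1 := fun q => by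
    rw [conj_chi]; unfold chi; rw [norm_prod]
    exact Finset.prod_eq_one fun μ _ => by rw [ZMod.stdAddChar_apply, Circle.norm_coe]
  rw [hnorm, hA, norm_mul, norm_inv, Complex.norm_natCast]
  have hsum : ‖∑ q : Tor M, conj (chi M q b)
        * ∑ w ∈ digitBox d N, modeTerm (DeltaEff a N m2 (sOf M q)) (N : ℝ)⁻¹ m2 (aliasPt (sOf M q) w)
            (fun μ => ((x μ).val : ℝ) / N)‖ ≤ ∑ _q : Tor M, Bd := by
    refine (norm_sum_le _ _).trans (Finset.sum_le_sum fun q _ => ?_)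
    rw [norm_mul, hchi q, one_mul]
    exact hq q
  calc (Fintype.card (Tor M) : ℝ)⁻¹ * _ ≤ (Fintype.card (Tor M) : ℝ)⁻¹ * ∑ _q : Tor M, Bd :=
        mul_le_mul_of_nonneg_left hsum (by positivity)
    _ = Bd := by
        rw [Finset.sum_const, Finset.card_univ, nsmul_eq_mul, ← mul_assoc, inv_mul_cancel₀ hcard, one_mul]

/-! ## §4 «Combining our bounds with Theorem 3.3»: the printed shape of (3.71) from the sup rate and uniform decay -/

/-- **(3.71), FIRST LINE, IN ITS PRINTED SHAPE, MODULO THEOREM 3.3**: if both kernels obey the uniform exponential decay of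
King's Theorem 3.3 / [Ba 4] at the point pair — `|ℋ_k(x,b)|, |ℋ_{k+n}(x′,b)| ≤ c₀e^{−δ₀t}` for some `t` (the distance
`|x − b|` in whichever metric the consumer uses) — then the sup rate `king_prop38_torus` upgrades to
`|ℋ_{k+n}(x′,b) − ℋ_k(x,b)| ≤ √(2c₀(C₁+C₂)L^{−γk})·e^{−δ₀t/2}`, i.e. `CL^{−γ′k}exp[−δ₀′|x − b|]` with `γ′ = γ/2`,
`δ₀′ = δ₀/2` — King p. 674: «combining our bounds with Theorem 3.3 we deduce (3.71)».  The decay hypotheses are INPUTS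
here (Theorem 3.3 is [Ba 4]; the tree's zero-field torus instance is the lit-balaban cell's `B4Thm110ZeroTorus`, in the
`B1RG242Torus` currency). [cite: King1986, Prop. 3.8 (3.71) p.664, p.674] -/
theorem king_prop38_torus_of_decay (hd : 0 < d) {L : ℕ} [NeZero L] (hLodd : Odd L) (hL : 2 ≤ L) {k n : ℕ}
    (hk : 1 ≤ k) (hn : 1 ≤ n) (M : Fin d → ℕ) [hM : ∀ μ, NeZero (M μ)] {a m2 : ℝ} (ha : 0 < a) (hm : 0 < m2)
    {γ : ℝ} (hγ0 : 0 ≤ γ) (hγ1 : γ ≤ 1) (b : Tor M) (x : Tor (fine (L ^ k) M))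
    (x' : Tor (fine (L ^ n * L ^ k) M)) (hx : ∀ μ, (x μ).val = (x' μ).val / L ^ n)
    {c₀ δ₀ t : ℝ}
    (hdecA : |minimiser (L ^ k) M (aK a L k) (((L ^ k : ℕ) : ℝ) ^ 2) m2 (Pi.single b 1) x|
      ≤ c₀ * Real.exp (-(δ₀ * t)))
    (hdecB : |minimiser (L ^ n * L ^ k) M (aK a L (k + n)) (((L ^ n * L ^ k : ℕ) : ℝ) ^ 2) m2 (Pi.single b 1) x'|
      ≤ c₀ * Real.exp (-(δ₀ * t))) :
    |minimiser (L ^ n * L ^ k) M (aK a L (k + n)) (((L ^ n * L ^ k : ℕ) : ℝ) ^ 2) m2 (Pi.single b 1) x'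
        - minimiser (L ^ k) M (aK a L k) (((L ^ k : ℕ) : ℝ) ^ 2) m2 (Pi.single b 1) x|
      ≤ Real.sqrt (((prop38RateConst a a (lemma43Const a L k n) ((π ^ 2 / 4) ^ d) d γ
              + prop38PosConst a ((π ^ 2 / 4) ^ d) d γ) * ((L ^ k : ℕ) : ℝ) ^ (-γ)) * (2 * c₀))
          * Real.exp (-(δ₀ / 2 * t)) := by
  have hrate := king_prop38_torus hd hLodd hL hk hn M ha hm hγ0 hγ1 b x x' hx
  have hε : 0 ≤ (prop38RateConst a a (lemma43Const a L k n) ((π ^ 2 / 4) ^ d) d γ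
      + prop38PosConst a ((π ^ 2 / 4) ^ d) d γ) * ((L ^ k : ℕ) : ℝ) ^ (-γ) := (abs_nonneg _).trans hrate
  refine abs_le_sqrt_mul_exp_half hε hrate ?_
  calc |minimiser (L ^ n * L ^ k) M (aK a L (k + n)) (((L ^ n * L ^ k : ℕ) : ℝ) ^ 2) m2 (Pi.single b 1) x'
          - minimiser (L ^ k) M (aK a L k) (((L ^ k : ℕ) : ℝ) ^ 2) m2 (Pi.single b 1) x|
      ≤ |minimiser (L ^ n * L ^ k) M (aK a L (k + n)) (((L ^ n * L ^ k : ℕ) : ℝ) ^ 2) m2 (Pi.single b 1) x'|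
        + |minimiser (L ^ k) M (aK a L k) (((L ^ k : ℕ) : ℝ) ^ 2) m2 (Pi.single b 1) x| := abs_sub _ _
    _ ≤ c₀ * Real.exp (-(δ₀ * t)) + c₀ * Real.exp (-(δ₀ * t)) := add_le_add hdecB hdecA
    _ = 2 * c₀ * Real.exp (-(δ₀ * t)) := by ring

end Torus

end Literature.MathematicalPhysics.QuantumFieldTheory.King1986
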